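import Summits.CriticalPhenomena.PercolationContinuityZ3.Theorems.Transplant.CayleySkeletonSign
import Summits.CriticalPhenomena.PercolationContinuityZ3.Theorems.Transplant.SkelSignCustomersAll
import HarnessLib

/-!
# The abstract Cayley-graph theorem, SIDE-ON version: ONE reversible additive height `ψ : Γ → ℤ` on `Cay(Γ; S)` gives `θ(p_c) = 0`
# at every vertex of `Cay(Γ; S) □ ℤ` — for every group `Γ`, no central element asked for

builds on p205010 (kernel theorem, internal audit signed; external expert review pending) — `CayleyLine.prodInt_criticalContinuity` runs
through the closed multi-type D″ node (`LineSkeletonNeg.prodInt_criticalContinuity_holds`, p3-g8/p4-g8), whose proof uses near-one gluing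
(AdditiveGluing), which builds on p205010.
Lane `prim-bschramm`, seat `prim-bschramm-p4` (gen 9; PART C3, METHOD = abstract closing argument); helper file
(`--supports stmt-CriticalPhenomena-4575 --as helper`).  Memo `HOME/bschramm/P4-GENERAL.md` §25.  Sibling of `CayleySkeletonSign` (§1 there:
`leftMulIso`, `autOfMulEquiv`, `degree_mulCayley_le`).

THE POINT (P4-GENERAL §22.2 (iii), stated once): the side-on class "X □ ℤ, X with a reflectable height" for X a Cayley graph needs exactly:
an additive `ψ : Γ → ℤ` with `|ψ(s)| ≤ 1` on `S` and `ψ(s₀) = 1` for some generator, ONE group automorphism `ν` with `ν(S) = S` and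
`ψ ∘ ν = −ψ`, and connected strips `{|ψ| ≤ ℓ}` (`ℓ ≥ 1`; group-theoretic form: `S ∩ ker ψ` generates `ker ψ`, file `CayleySkeletonKernel`).
Then `CayleyLine.lineSkeleton : LineSkeletonNeg (Cay(Γ;S))` (one type) and **`θ_v(p_c) = 0` at every vertex of `Cay(Γ; S) □ ℤ`,
UNCONDITIONALLY** (Φ2 by tubes, `BoxProdZdTubes`).  Members: `ℤ^d`, `N_{m,2}` (`ψ = x_{i₀}`, `ν = s ↦ s⁻¹` on generators), `Cay(H₃; S)` for
x-reversible `S`, every `Γ` with a character that some `S`-preserving automorphism reverses.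
* §1 `CayleyLine`, `ψ_one`, `ψ_inv`, **`CayleyLine.lineSkeleton`**, **`CayleyLine.prodInt_criticalContinuity`**.
[cite: BenjaminiSchramm1996, Conj. 4; §2 (Cayley graphs)] [cite: MartineauSevero2019, Cor. 2.2]
[cite: KozmaNitzan2024, §4 p. 16 (Lemma 8: the lattice symmetries)]
-/

noncomputable section

namespace Summit.CriticalPhenomena.PercolationContinuityZ3.Theorems.Transplant

open MeasureTheory Literature.Probability.Percolation Literature.Probability.LatticeModels SimpleGraph
open scoped Classical

/-! ## §1 `CayleyLine`: one reversible additive height gives `θ(p_c) = 0` on `Cay(Γ; S) □ ℤ` -/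

/-- **One reversible height on a Cayley graph**: `ψ : Γ → ℤ` additive, `|ψ(s)| ≤ 1` on `S`, `ψ(s₀) = 1` for some generator, ONE
`S`-preserving automorphism `ν` with `ψ ∘ ν = −ψ`, connected strips `{|ψ| ≤ ℓ}`, `ℓ ≥ 1`.  No central element is asked for.
[cite: KozmaNitzan2024, §4 p. 16 (Lemma 8)] [cite: BenjaminiSchramm1996, §2] -/
structure CayleyLine (Γ : Type) [Group Γ] (S : Finset Γ) where
  /-- the height `ψ : Γ → ℤ` -/
  ψ : Γ → ℤ
  /-- additivity -/
  map_mul : ∀ g h : Γ, ψ (g * h) = ψ g + ψ h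
  /-- generators have height `≤ 1` in absolute value -/
  lip : ∀ s ∈ S, |ψ s| ≤ 1
  /-- some generator has height `1` -/
  step : ∃ s ∈ S, ψ s = 1
  /-- the reversing automorphism -/
  ν : Γ ≃* Γ
  /-- `ν` preserves the generating system -/
  ν_mem : ∀ s, ν s ∈ S ↔ s ∈ S
  /-- `ψ ∘ ν = −ψ` -/
  ν_ψ : ∀ g, ψ (ν g) = -ψ g
  /-- (κ) connected strips -/
  strip_connected : ∀ ℓ : ℕ, 1 ≤ ℓ → ((mulCayley (S : Set Γ)).induce {g | |ψ g| ≤ ℓ}).Connected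

namespace CayleyLine

variable {Γ : Type} [Group Γ] {S : Finset Γ} (L : CayleyLine Γ S)

/-- `ψ 1 = 0`. [folklore] -/
theorem ψ_one : L.ψ 1 = 0 := by
  have h := L.map_mul 1 1
  rw [one_mul] at h
  linarith

/-- `ψ g⁻¹ = −ψ g`. [folklore] -/
theorem ψ_inv (g : Γ) : L.ψ g⁻¹ = -L.ψ g := by
  have h := L.map_mul g⁻¹ g
  rw [inv_mul_cancel, ψ_one] at h
  linarith

/-- **THE LINE SKELETON OF A `CayleyLine`** (one type, the identity; `ν` the reflection). [cite: KozmaNitzan2024, §4 p. 16 (Lemma 8)] -/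
def lineSkeleton : LineSkeletonNeg (mulCayley (S : Set Γ)) where
  ψ := L.ψ
  lip := by
    intro u v h
    rw [mulCayley_adj] at h
    obtain ⟨-, h | h⟩ := h
    · have h1 := L.lip _ (Finset.mem_coe.1 h)
      rw [L.map_mul, ψ_inv] at h1
      rw [abs_sub_comm]
      convert h1 using 2; ring
    · have h1 := L.lip _ (Finset.mem_coe.1 h)
      rw [L.map_mul, ψ_inv] at h1
      convert h1 using 2; ring
  types := {1}
  frame := fun v => ⟨1, Finset.mem_singleton_self 1, leftMulIso S v, mul_one v, fun w => by
    show L.ψ (v * w) = L.ψ w + (L.ψ v - L.ψ 1)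
    rw [L.map_mul, ψ_one]; ring⟩
  neg := fun t ht => by
    rw [Finset.mem_singleton] at ht
    subst ht
    refine ⟨autOfMulEquiv S L.ν L.ν_mem, map_one L.ν, fun w => ?_⟩
    show L.ψ (L.ν w) - L.ψ 1 = -(L.ψ w - L.ψ 1)
    rw [ψ_one, sub_zero, sub_zero, L.ν_ψ]
  Δ := 2 * S.card
  degree_le := degree_mulCayley_le S
  step := fun v σ => by
    obtain ⟨s, hs, hψ⟩ := L.step
    have hs1 : s ≠ 1 := by intro h; rw [h, ψ_one] at hψ; exact zero_ne_one hψ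
    rcases Int.units_eq_one_or σ with rfl | rfl
    · refine ⟨v * s, ?_, by rw [L.map_mul, hψ, Units.val_one]⟩
      rw [mulCayley_adj]
      refine ⟨fun h => hs1 (mul_left_cancel (a := v) (by rw [mul_one]; exact h.symm)), Or.inl ?_⟩
      rw [inv_mul_cancel_left]; exact Finset.mem_coe.2 hs
    · refine ⟨v * s⁻¹, ?_, by rw [L.map_mul, ψ_inv, hψ, Units.val_neg, Units.val_one]⟩
      rw [mulCayley_adj]
      refine ⟨fun h => hs1 (inv_eq_one.1 (mul_left_cancel (a := v) (by rw [mul_one]; exact h.symm))), Or.inr ?_⟩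
      rw [mul_inv_rev, inv_inv, inv_mul_cancel_right]; exact Finset.mem_coe.2 hs
  strip_connected := fun t ht ℓ hℓ => by
    rw [Finset.mem_singleton] at ht
    subst ht
    have e : {w | |L.ψ w - L.ψ 1| ≤ (ℓ : ℤ)} = {g | |L.ψ g| ≤ ℓ} := by
      ext w; simp [ψ_one]
    rw [e]
    exact L.strip_connected ℓ hℓ

/-- **THEOREM (unconditional): `θ_v(p_c) = 0` at every vertex of `Cay(Γ; S) □ ℤ`** for every group `Γ` and generating system `S` carrying
ONE reversible additive height (`CayleyLine`): the side-on customer of the closed multi-type D″ node, Φ2 by tubes.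
builds on p205010 (kernel theorem, internal audit signed; external expert review pending).
[cite: BenjaminiSchramm1996, Conj. 4; §2] [cite: MartineauSevero2019, Cor. 2.2] -/
theorem prodInt_criticalContinuity (L : CayleyLine Γ S) [(mulCayley (S : Set Γ) □ zdGraph 1).LocallyFinite] (v : Γ × Site 1) :
    theta (mulCayley (S : Set Γ) □ zdGraph 1) v (criticalProbIOf (mulCayley (S : Set Γ) □ zdGraph 1) v) = 0 :=
  L.lineSkeleton.prodInt_criticalContinuity_holds v

end CayleyLine

end Summit.CriticalPhenomena.PercolationContinuityZ3.Theorems.Transplant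

end
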